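import Summits.CriticalPhenomena.SAWScalingLimit.Theorems.SAWRenewalTightnessRoomEntropyDefs
import Literature.Probability.RandomPlanarGeometry.LoewnerRoomObservableFarField
import Literature.Probability.Process.LocalMartingaleFromObservables
import Literature.Probability.RandomPlanarGeometry.SLELawOfDrivingProcessLocal
import Literature.Probability.RandomPlanarGeometry.DrivingFunctionMeasurable
import Literature.Probability.RandomPlanarGeometry.LoewnerDescription
import HarnessLib

/-!
# `stub_roomEntropyCharacterisesSLECap`: the time-capped room–entropy martingales characterise SLE(8/3)

Stub `stub_roomEntropyCharacterisesSLECap` of the registered skeleton (reshape r6, time-capped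
passage architecture) of the line `room-entropy-wright-fisher` for the crux `SubseqIdentification`
(stmt-CriticalPhenomena-0783, route `SAWRenewalTightness`, shared with `SAWParafermion` /
`SAWLeftRightFKG` / `SAWAsymptoticMorera`; vocabulary
`Theorems/SAWRenewalTightnessRoomEntropyDefs.lean`): the CONTINUUM ENDGAME of the line in its
capped form. If `ν` is a probability measure on curve classes, `ν`-a.e. class is
Loewner-describable through the chordal uniformizing map `φ` and starts at `a = D.pt 0`, the
driving process `W = drivingFunction φ` is adapted to a filtration `𝓕`, and for every `w ∈ ℍ` the
TIME-CAPPED room–entropy observable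
`t ↦ N^{w,m_w}_{t ∧ T_w} = roomObsStopped W w m_w (t ∧ T_w)`, `m_w = ⌈(Im w)²/16⌉₊`,
`T_w = (Im w)²/16` (`N = log ψ + 3 H(S)`, `ψ = Loewner.derivRatio`, `S = Loewner.schrammObs`,
stopped at the room stop `roomStop W w m_w` and frozen after the deterministic time `T_w`), is an
`𝓕`-martingale, then `ν` is the chordal SLE(8/3) law of `(D; a, b)`.

Proof. The landed uncapped endgame (`stub_roomEntropyCharacterisesSLE`,
`Theorems/SAWRenewalTightnessSubseqIdentificationRoomEntropyCharacterisesSLE.lean`) only ever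
evaluates the observable at FAR points `w = y(3+4i)/5`, `w = iy` with `y ≥ 64 (K + √T) + 1` and at
times `r ≤ T`; there `T ≤ y²/4096 ≤ (Im w)²/16 = T_w`, so the cap is inactive, and the far-field
lemma `Loewner.FarRegime.le_roomStop` (`Im w ≥ ‖w‖/2`, `1 ≤ m_w`, `r ≤ (Im w)²/16 ≤ m_w + 1`) shows
that the room stop at level `m_w` has not occurred either: the capped process equals the raw
combination `N_r(w)` (`roomObsStopped_cap_eq_roomObs`). The two far-field expansions
`Loewner.FarRegime.abs_roomObs_offAxis_sub_le` (first order, coefficient `(24 log 4/25)/y ≠ 0` of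
`W_r`) and `Loewner.FarRegime.abs_roomObs_I_sub_le` (second order, `-(3/2)(W_r² - (8/3) r)/y²`)
then give the approximation statements `exists_level_roomObsCap_order_one/two` (the capped
twins of `Loewner.exists_level_roomObs_order_one/two`, same constants), which feed the exit-time
localisation `Literature.Probability.Process.isLocalMartingale_hasQuadraticVariation_of_approx`
(continuity of the capped process: `Loewner.continuous_roomObs_min` composed with `t ↦ t ∧ T_w`);
the tree's `isSLELaw_of_isLocalMartingale_driving_of_lt_four` (`0 < 8/3 < 4`; `W_0 = 0` a.e. from
`drivingFunction_apply_zero`; describability read as `Loewner.IsDrivenBy` through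
`isLoewnerDescribed_iff_isDrivenBy`, `isLoewnerDescribed_drivingFunction`) concludes.

No named fact is used; axioms `propext`, `Classical.choice`, `Quot.sound`.

References: G. F. Lawler, O. Schramm, W. Werner, Ann. Probab. 32 (2004), §3 and Proc. Sympos.
Pure Math. 72 (2004), §2 (martingale-observable identification); D. Chelkak, H. Duminil-Copin,
C. Hongler, A. Kemppainen, S. Smirnov, C. R. Math. Acad. Sci. Paris 352 (2014), §3 (deterministic
time cap at a far point); S. Rohde, O. Schramm, Ann. of Math. 161 (2005), Lemma 6.3, eq. (6.3).
-/

noncomputable section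

open MeasureTheory Filter Topology Set
open scoped NNReal ENNReal Classical BigOperators
open Literature.Probability.LatticeModels
open Literature.Probability.RandomPlanarGeometry
open UpperHalfPlane (upperHalfPlaneSet)

namespace Summit.CriticalPhenomena.SAWScalingLimit.Theorems.SubseqIdentification.RoomEntropy

/-! ## Neither the cap nor the room stop bites in the far field -/

/-- **In the far-field regime the capped, stopped observable is the raw combination**: if
`Loewner.FarRegime W w r K`, `Im w ≥ ‖w‖/2` and `r ≤ (Im w)²/16 = T_w`, then
`roomObsStopped W w m_w (r ∧ T_w) = roomObs W w r = log ψ_r(w) + 3 H(S_r(w))` with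
`m_w = ⌈(Im w)²/16⌉₊`: the cap is inactive (`r ≤ T_w`) and the room stop at level `m_w ≥ 1` has
not occurred by time `r ≤ T_w ≤ m_w + 1` (`Loewner.FarRegime.le_roomStop`). [folklore] -/
theorem roomObsStopped_cap_eq_roomObs {W : ℝ≥0 → ℝ} {w : ℂ} {r : ℝ≥0} {K : ℝ}
    (h : Loewner.FarRegime W w r K) (hw : ‖w‖ / 2 ≤ w.im) (hr : (r : ℝ) ≤ w.im ^ 2 / 16) :
    roomObsStopped W w ⌈w.im ^ 2 / 16⌉₊ (min r (Real.toNNReal (w.im ^ 2 / 16))) =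
      roomObs W w r := by
  have hwim : 0 < w.im := lt_of_lt_of_le (half_pos h.pos) hw
  have hrT : r ≤ Real.toNNReal (w.im ^ 2 / 16) :=
    (Real.le_toNNReal_iff_coe_le (by positivity)).2 hr
  have hm : 1 ≤ ⌈w.im ^ 2 / 16⌉₊ := Nat.one_le_ceil_iff.2 (by positivity)
  have htm : (r : ℝ) ≤ (⌈w.im ^ 2 / 16⌉₊ : ℕ) + 1 := by
    have := Nat.le_ceil (w.im ^ 2 / 16)
    linarith
  have hstop : r ≤ roomStop W w ⌈w.im ^ 2 / 16⌉₊ := h.le_roomStop hw hm htm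
  rw [min_eq_left hrT, roomObsStopped, min_eq_left hstop]

/-- **The capped, stopped room–entropy observable is continuous in time**:
`t ↦ roomObsStopped W w m (t ∧ T₀)` is continuous for every continuous driving function, `w ∈ ℍ`,
cap `m` and deterministic time `T₀` (`Loewner.continuous_roomObs_min` composed with the continuous
map `t ↦ t ∧ T₀`). [folklore] -/
theorem continuous_roomObsStopped_min {W : ℝ≥0 → ℝ} (hW : Continuous W) {w : ℂ} (hw : 0 < w.im)
    (m : ℕ) (T₀ : ℝ≥0) : Continuous fun t : ℝ≥0 ↦ roomObsStopped W w m (min t T₀) :=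
  (Loewner.continuous_roomObs_min hW hw m).comp (continuous_id.min continuous_const)

/-! ## The two capped approximation statements -/

/-- **Order one (the driver), capped form.** For every driver bound `K ≥ 0`, horizon `T` and
`ε > 0` there is a level `y > 0` such that, for EVERY continuous driving function `W` and every
time `r ≤ T` with `|W| ≤ K` on `[0, r]`, the capped, stopped room–entropy observable at
`w = y(3+4i)/5` (cap level `m_w = ⌈(Im w)²/16⌉₊`, cap time `T_w = (Im w)²/16`) satisfies
`|N^{w,m_w}_{r ∧ T_w} - (a W_r + 3 H(4/5))| ≤ ε |a|` with the nonzero constant `a = (24 log 4/25)/y`: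
`y ≥ 64 (K + √T) + 1` forces `T ≤ y²/4096 ≤ T_w = y²/25`, so `roomObsStopped_cap_eq_roomObs` and
the far-field expansion `Loewner.FarRegime.abs_roomObs_offAxis_sub_le` apply (the capped twin of
`Loewner.exists_level_roomObs_order_one`, same constants). [folklore] -/
theorem exists_level_roomObsCap_order_one {K : ℝ} (hK : 0 ≤ K) (T : ℝ≥0) {ε : ℝ} (hε : 0 < ε) :
    ∃ y : ℝ, 0 < y ∧ ∀ (W : ℝ≥0 → ℝ), Continuous W → ∀ r : ℝ≥0, r ≤ T →
      (∀ u, u ≤ r → |W u| ≤ K) →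
      |roomObsStopped W (y * (3 + 4 * Complex.I) / 5)
            ⌈(y * (3 + 4 * Complex.I) / 5 : ℂ).im ^ 2 / 16⌉₊
            (min r (Real.toNNReal ((y * (3 + 4 * Complex.I) / 5 : ℂ).im ^ 2 / 16))) -
          (24 / 25 * Real.log 4 / y * W r + 3 * Real.binEntropy (4 / 5))| ≤
        ε * |24 / 25 * Real.log 4 / y| := by
  set M := K + Real.sqrt T with hMdef
  have hM0 : 0 ≤ M := add_nonneg hK (Real.sqrt_nonneg _)
  have hlog4 : 0 < Real.log 4 := Real.log_pos (by norm_num)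
  set y : ℝ := max (64 * M) (130 * M ^ 2 * 25 / (24 * Real.log 4 * ε)) + 1 with hydef
  have hy64' : 64 * M + 1 ≤ y := by
    rw [hydef]; exact add_le_add (le_max_left _ _) le_rfl
  have hy64 : 64 * M ≤ y := by linarith
  have hy2 : 130 * M ^ 2 * 25 / (24 * Real.log 4 * ε) ≤ y :=
    (le_max_right _ _).trans (by rw [hydef]; exact le_add_of_nonneg_right zero_le_one)
  have hy : 0 < y := by
    have : (0 : ℝ) ≤ 64 * M := by positivity
    linarith
  have hTy : (T : ℝ) ≤ y ^ 2 / 4096 := by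
    have h0 : 0 ≤ Real.sqrt T := Real.sqrt_nonneg _
    have h1 : Real.sqrt T ^ 2 = T := Real.sq_sqrt T.coe_nonneg
    have h2 : 64 * Real.sqrt T ≤ y := by
      have h3 := hy64
      rw [hMdef] at h3
      linarith
    nlinarith [mul_nonneg (sub_nonneg.2 h2)
      (add_nonneg hy.le (mul_nonneg (by norm_num : (0 : ℝ) ≤ 64) h0))]
  refine ⟨y, hy, fun W hW r hr hbd ↦ ?_⟩
  have hnorm := Loewner.FarRegime.norm_offAxis hy
  obtain ⟨-, hwim⟩ := Loewner.FarRegime.re_im_offAxis y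
  have hrT' : (r : ℝ) ≤ T := NNReal.coe_le_coe.2 hr
  have hrT : Real.sqrt r ≤ Real.sqrt T := Real.sqrt_le_sqrt hrT'
  have hreg : Loewner.FarRegime W (y * (3 + 4 * Complex.I) / 5) r K :=
    Loewner.farRegime_of_bound hW hbd (by rw [hnorm]; linarith) (by rw [hnorm]; exact hy)
  have him2 : ‖(y * (3 + 4 * Complex.I) / 5 : ℂ)‖ / 2 ≤ (y * (3 + 4 * Complex.I) / 5 : ℂ).im := by
    rw [hnorm, hwim]; linarith
  have hcap : (r : ℝ) ≤ (y * (3 + 4 * Complex.I) / 5 : ℂ).im ^ 2 / 16 := by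
    rw [hwim]; nlinarith [sq_nonneg y]
  rw [roomObsStopped_cap_eq_roomObs hreg him2 hcap, roomObs]
  have hexp := hreg.abs_roomObs_offAxis_sub_le hy
  have hid : Real.log (Loewner.derivRatio W (y * (3 + 4 * Complex.I) / 5) r) +
        3 * Real.binEntropy (Loewner.schrammObs W (y * (3 + 4 * Complex.I) / 5) r) -
        (24 / 25 * Real.log 4 / y * W r + 3 * Real.binEntropy (4 / 5)) =
      Real.log (Loewner.derivRatio W (y * (3 + 4 * Complex.I) / 5) r) +
        3 * Real.binEntropy (Loewner.schrammObs W (y * (3 + 4 * Complex.I) / 5) r) -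
        3 * Real.binEntropy (4 / 5) - 24 / 25 * Real.log 4 * (W r / y) := by
    field_simp; ring
  rw [hid]
  refine hexp.trans ?_
  have ha : |24 / 25 * Real.log 4 / y| = 24 / 25 * Real.log 4 / y := abs_of_pos (by positivity)
  rw [ha]
  have hKr : K + Real.sqrt r ≤ M := by rw [hMdef]; linarith
  have h1 : (K + Real.sqrt r) / y ≤ M / y := by gcongr
  have h0 : 0 ≤ (K + Real.sqrt r) / y := by positivity
  calc 130 * ((K + Real.sqrt r) / y) ^ 2 ≤ 130 * (M / y) ^ 2 := by gcongr
    _ = (130 * M ^ 2 / y) / y := by field_simp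
    _ ≤ (ε * (24 / 25 * Real.log 4)) / y := by
        gcongr
        rw [div_le_iff₀ hy]
        have := (div_le_iff₀ (by positivity : (0 : ℝ) < 24 * Real.log 4 * ε)).1 hy2
        nlinarith
    _ = ε * (24 / 25 * Real.log 4 / y) := by ring

/-- **Order two (the quadratic term), capped form.** For every `K ≥ 0`, `T` and `ε > 0` there is
`y > 0` such that, for every continuous `W` and `r ≤ T` with `|W| ≤ K` on `[0, r]`, the capped,
stopped room–entropy observable at `w = iy` (cap level `⌈y²/16⌉₊`, cap time `y²/16`) satisfies
`|N^{iy,m_w}_{r ∧ T_w} - (a (W_r² - (8/3) r) + 3 log 2)| ≤ ε |a|`, `a = -(3/2)/y²`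
(`y ≥ 64 (K + √T) + 1` gives `T ≤ y²/4096 ≤ y²/16`; then `roomObsStopped_cap_eq_roomObs` and the
far-field expansion `Loewner.FarRegime.abs_roomObs_I_sub_le`: `4r - (3/2) W_r² = -(3/2)(W_r² - (8/3) r)`,
whence `κ = 8/3`; the capped twin of `Loewner.exists_level_roomObs_order_two`). [folklore] -/
theorem exists_level_roomObsCap_order_two {K : ℝ} (hK : 0 ≤ K) (T : ℝ≥0) {ε : ℝ} (hε : 0 < ε) :
    ∃ y : ℝ, 0 < y ∧ ∀ (W : ℝ≥0 → ℝ), Continuous W → ∀ r : ℝ≥0, r ≤ T →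
      (∀ u, u ≤ r → |W u| ≤ K) →
      |roomObsStopped W (Complex.I * y) ⌈(Complex.I * y : ℂ).im ^ 2 / 16⌉₊
            (min r (Real.toNNReal ((Complex.I * y : ℂ).im ^ 2 / 16))) -
          (-(3 / 2) / y ^ 2 * (W r ^ 2 - 8 / 3 * r) + 3 * Real.log 2)| ≤
        ε * |-(3 / 2) / y ^ 2| := by
  set M := K + Real.sqrt T with hMdef
  have hM0 : 0 ≤ M := add_nonneg hK (Real.sqrt_nonneg _)
  set y : ℝ := max (64 * M) (140 * M ^ 3 * (2 / 3) / ε) + 1 with hydef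
  have hy64' : 64 * M + 1 ≤ y := by
    rw [hydef]; exact add_le_add (le_max_left _ _) le_rfl
  have hy64 : 64 * M ≤ y := by linarith
  have hy2 : 140 * M ^ 3 * (2 / 3) / ε ≤ y :=
    (le_max_right _ _).trans (by rw [hydef]; exact le_add_of_nonneg_right zero_le_one)
  have hy : 0 < y := by
    have : (0 : ℝ) ≤ 64 * M := by positivity
    linarith
  have hTy : (T : ℝ) ≤ y ^ 2 / 4096 := by
    have h0 : 0 ≤ Real.sqrt T := Real.sqrt_nonneg _
    have h1 : Real.sqrt T ^ 2 = T := Real.sq_sqrt T.coe_nonneg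
    have h2 : 64 * Real.sqrt T ≤ y := by
      have h3 := hy64
      rw [hMdef] at h3
      linarith
    nlinarith [mul_nonneg (sub_nonneg.2 h2)
      (add_nonneg hy.le (mul_nonneg (by norm_num : (0 : ℝ) ≤ 64) h0))]
  refine ⟨y, hy, fun W hW r hr hbd ↦ ?_⟩
  have hnorm := Loewner.FarRegime.norm_I_mul hy
  have hwim : (Complex.I * y : ℂ).im = y := by simp
  have hrT' : (r : ℝ) ≤ T := NNReal.coe_le_coe.2 hr
  have hrT : Real.sqrt r ≤ Real.sqrt T := Real.sqrt_le_sqrt hrT'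
  have hreg : Loewner.FarRegime W (Complex.I * y) r K :=
    Loewner.farRegime_of_bound hW hbd (by rw [hnorm]; linarith) (by rw [hnorm]; exact hy)
  have him2 : ‖(Complex.I * y : ℂ)‖ / 2 ≤ (Complex.I * y : ℂ).im := by rw [hnorm, hwim]; linarith
  have hcap : (r : ℝ) ≤ (Complex.I * y : ℂ).im ^ 2 / 16 := by
    rw [hwim]; nlinarith [sq_nonneg y]
  rw [roomObsStopped_cap_eq_roomObs hreg him2 hcap, roomObs]
  have hexp := hreg.abs_roomObs_I_sub_le hy
  have hy2' : y ^ 2 ≠ 0 := by positivity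
  have hid : Real.log (Loewner.derivRatio W (Complex.I * y) r) +
        3 * Real.binEntropy (Loewner.schrammObs W (Complex.I * y) r) -
        (-(3 / 2) / y ^ 2 * (W r ^ 2 - 8 / 3 * r) + 3 * Real.log 2) =
      Real.log (Loewner.derivRatio W (Complex.I * y) r) +
        3 * Real.binEntropy (Loewner.schrammObs W (Complex.I * y) r) -
        3 * Real.log 2 - (4 * r - 3 / 2 * W r ^ 2) / y ^ 2 := by
    field_simp; ring
  rw [hid]
  refine hexp.trans ?_
  have ha : |-(3 / 2) / y ^ 2| = 3 / 2 / y ^ 2 := by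
    rw [abs_div, abs_neg, abs_of_pos (by norm_num : (0 : ℝ) < 3 / 2), abs_of_pos (by positivity)]
  rw [ha]
  have hKr : K + Real.sqrt r ≤ M := by rw [hMdef]; linarith
  have h1 : (K + Real.sqrt r) / y ≤ M / y := by gcongr
  have h0 : 0 ≤ (K + Real.sqrt r) / y := by positivity
  calc 140 * ((K + Real.sqrt r) / y) ^ 3 ≤ 140 * (M / y) ^ 3 := by gcongr
    _ = (140 * M ^ 3 / y) / y ^ 2 := by field_simp
    _ ≤ (ε * (3 / 2)) / y ^ 2 := by
        gcongr
        rw [div_le_iff₀ hy]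
        have := (div_le_iff₀ hε).1 hy2
        nlinarith
    _ = ε * (3 / 2 / y ^ 2) := by ring

/-! ## The capped endgame -/

/-- **The time-capped room–entropy martingales characterise SLE(8/3)** (registered stub
`stub_roomEntropyCharacterisesSLECap` of the line `room-entropy-wright-fisher`, reshape r6, crux
`SubseqIdentification`, stmt-CriticalPhenomena-0783): for a probability measure `ν` on curve
classes carried by Loewner-describable classes from `a = D.pt 0`, a filtration to which the
driving process `drivingFunction φ` is adapted, and the martingale property, for every `w ∈ ℍ`,
of the capped, stopped room–entropy observable
`t ↦ roomObsStopped (drivingFunction φ c) w ⌈(Im w)²/16⌉₊ (t ∧ (Im w)²/16)`, the measure `ν` is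
the chordal SLE(8/3) law of `D`. Proof: the two capped far-field channels
(`exists_level_roomObsCap_order_one` at `y(3+4i)/5`, `exists_level_roomObsCap_order_two` at
`iy`; on the relevant paths and times neither the cap nor the room stop bites) feed the exit-time
localisation `Process.isLocalMartingale_hasQuadraticVariation_of_approx`, and the tree's
`isSLELaw_of_isLocalMartingale_driving_of_lt_four` (`0 < 8/3 < 4`) concludes. -/
theorem stub_roomEntropyCharacterisesSLECap :
    ∀ (D : DobrushinDomain) (φ : ConformalEquiv upperHalfPlaneSet D.carrier)
      (ν : Measure (CurveClass ℂ)),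
      D.IsChordalUniformizing φ → IsProbabilityMeasure ν →
      (∀ᵐ c ∂ν, IsLoewnerDescribable φ c ∧ c.source = D.pt 0) →
      ∀ 𝓕 : Filtration ℝ≥0 (inferInstance : MeasurableSpace (CurveClass ℂ)),
        Adapted 𝓕 (fun t c => drivingFunction φ c t) →
        (∀ w : ℂ, 0 < w.im →
          Martingale (fun t c => roomObsStopped (drivingFunction φ c) w ⌈w.im ^ 2 / 16⌉₊ (min t (Real.toNNReal (w.im ^ 2 / 16)))) 𝓕 ν) →
      IsSLELaw ((8 : ℝ≥0) / 3) D ν := by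
  intro D φ ν hφ hν hdesc 𝓕 hWad hN
  have hWc : ∀ c : CurveClass ℂ, Continuous fun t ↦ drivingFunction φ c t := fun c ↦
    continuous_drivingFunction φ c
  have hW0 : ∀ᵐ c ∂ν, drivingFunction φ c 0 = 0 := by
    filter_upwards [hdesc] with c hc
    exact drivingFunction_apply_zero hφ hc.2
  have h83 : (0 : ℝ≥0) < 8 / 3 := by norm_num
  have h83' : ((8 / 3 : ℝ≥0) : ℝ) = 8 / 3 := by norm_num
  -- order one: the capped room–entropy observable seen from `y (3 + 4i)/5`, `y → ∞`
  have h1 : ∀ K : ℝ, 0 < K → ∀ T : ℝ≥0, ∀ ε : ℝ, 0 < ε →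
      ∃ (Y : ℝ≥0 → CurveClass ℂ → ℝ) (a b : ℝ), a ≠ 0 ∧ Martingale Y 𝓕 ν ∧
        (∀ c, Continuous (Y · c)) ∧ ∀ᵐ c ∂ν, ∀ r : ℝ≥0, r ≤ T →
          (∀ u, u ≤ r → |drivingFunction φ c u| ≤ K) →
            |Y r c - (a * drivingFunction φ c r + b)| ≤ ε * |a| := by
    intro K hK T ε hε
    obtain ⟨y, hy, hP⟩ := exists_level_roomObsCap_order_one hK.le T hε
    have him : 0 < ((y : ℂ) * (3 + 4 * Complex.I) / 5).im := by
      rw [(Loewner.FarRegime.re_im_offAxis y).2]; positivity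
    refine ⟨fun t c ↦ roomObsStopped (drivingFunction φ c) (y * (3 + 4 * Complex.I) / 5)
        ⌈((y : ℂ) * (3 + 4 * Complex.I) / 5).im ^ 2 / 16⌉₊
        (min t (Real.toNNReal (((y : ℂ) * (3 + 4 * Complex.I) / 5).im ^ 2 / 16))),
      24 / 25 * Real.log 4 / y, 3 * Real.binEntropy (4 / 5), ?_, hN _ him,
      fun c ↦ continuous_roomObsStopped_min (hWc c) him _ _,
      ae_of_all _ fun c r hr hbd ↦ hP _ (hWc c) r hr hbd⟩
    have hlog4 : 0 < Real.log 4 := Real.log_pos (by norm_num)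
    positivity
  -- order two: the capped room–entropy observable seen from `iy`, `y → ∞`
  have h2 : ∀ K : ℝ, 0 < K → ∀ T : ℝ≥0, ∀ ε : ℝ, 0 < ε →
      ∃ (Y : ℝ≥0 → CurveClass ℂ → ℝ) (a b : ℝ), a ≠ 0 ∧ Martingale Y 𝓕 ν ∧
        (∀ c, Continuous (Y · c)) ∧ ∀ᵐ c ∂ν, ∀ r : ℝ≥0, r ≤ T →
          (∀ u, u ≤ r → |drivingFunction φ c u| ≤ K) →
            |Y r c - (a * (drivingFunction φ c r ^ 2 - ((8 / 3 : ℝ≥0) : ℝ) * r) + b)| ≤ ε * |a| := by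
    intro K hK T ε hε
    obtain ⟨y, hy, hP⟩ := exists_level_roomObsCap_order_two hK.le T hε
    have him : 0 < (Complex.I * (y : ℂ)).im := by simpa using hy
    refine ⟨fun t c ↦ roomObsStopped (drivingFunction φ c) (Complex.I * y)
        ⌈(Complex.I * (y : ℂ)).im ^ 2 / 16⌉₊
        (min t (Real.toNNReal ((Complex.I * (y : ℂ)).im ^ 2 / 16))),
      -(3 / 2) / y ^ 2, 3 * Real.log 2, ?_, hN _ him,
      fun c ↦ continuous_roomObsStopped_min (hWc c) him _ _,
      ae_of_all _ fun c r hr hbd ↦ by rw [h83']; exact hP _ (hWc c) r hr hbd⟩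
    have : (0 : ℝ) < 3 / 2 / y ^ 2 := by positivity
    rw [neg_div]; exact neg_ne_zero.2 this.ne'
  obtain ⟨hM, hQ⟩ :=
    Literature.Probability.Process.isLocalMartingale_hasQuadraticVariation_of_approx
      (W := fun t c ↦ drivingFunction φ c t) (P := ν) hWad hWc hW0 h83 h1 h2
  refine isSLELaw_of_isLocalMartingale_driving_of_lt_four h83 (by norm_num) hφ
    (measurable_drivingFunction_apply hφ) hW0 (ae_of_all _ fun c ↦ continuous_drivingFunction φ c)
    hM hQ ?_
  filter_upwards [hdesc] with c hc
  exact (isLoewnerDescribed_iff_isDrivenBy.1 (isLoewnerDescribed_drivingFunction hc.1)).2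

end Summit.CriticalPhenomena.SAWScalingLimit.Theorems.SubseqIdentification.RoomEntropy

end
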